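import Summits.RiemannHypothesis.RiemannHypothesis.Theorems.SemilocalNegCertSevenKinked1206
import HarnessLib

/-!
# Semi-local threshold of the `{∞,2,3,5,7}` form, negative side: `a*({2,3,5,7}) ≤ 603/500 = 1.206` from a KINKED (piecewise cubic) witness (part 2/3: the kernel facts piece 21 … piece 42)

Cell `rh-explicit` (HOME `run/shared/lean/pub/rh-explicit/`), seat cc-s2-4 gen8 (A4 SEMILOCAL-TABLE, kernel column; fifth instance of the
piecewise-witness layer `SemilocalPiecewise{Witness,Increment,IncrementSum,Cert}.lean` + `SemilocalArchDensityFar.lean`).  Honest framing: theorems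
about the tree's `weilSemilocalThreshold S`; nothing here bears on RH.  The instance is split into THREE files (`…Kinked1206`, `…1206B`, `…1206Final`)
of 22–23 kernel facts each; no data is trusted: 67 kernel facts (`decide +kernel`).

WHY KINKED (numbers, `HOME/cc-s2-4/gen8/KNEE-NOTE.md`): at `b = 603/500 = 1.206 = a*(S) + 0.0065` (`S = {2,3,5,7}`, DATA `a* = 1.1995`) the
polynomial class of degree ≤ 13 is at the very start of its steep branch (`−7e-10` at 1.206; the tree's row is `61/50 = 1.22` at degree 9,
`SemilocalNegCertSeven.lean`, and a degree-13 row at `1.21` is held), whereas an odd PIECEWISE CUBIC with breakpoints at ALL SEVEN atom images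
`|b − log n|`, `n = 3, 4, 5, 2, 7, 8, 9` (rounded to `14, 23, 52, 66, 95, 112, 127 /128`), gives `Re Q_S(G)/‖G‖² = −1.27·10⁻³` (form without the
polar credit).  Instance data: `N = 12` (atom table `atomsSeven`, `atomsEnclose_Seven`), 8 pieces of degree ≤ 3, 65 `t`-pieces, atoms
`2, 3, 4, 5, 7, 8, 9` in the pieces `27, 42, 50, 54, 60, 62, 63`; kernel margin `(rhs − lhs)/‖G‖² = 1.27·10⁻³`.
⇒ **`weilSemilocalThreshold {2,3,5,7} ≤ 603/500 = 1.206`** and for the class `2, 3, 5, 7 ∈ S ∌ 11`: `a*(S) ∈ [(log 5)/2, 1.206]`.  Folklore.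
-/

set_option autoImplicit false
set_option linter.dupNamespace false  -- the mandated namespace repeats `RiemannHypothesis`
set_option Elab.async false  -- serialise the kernel facts: in parallel they exhaust the node's per-process heap (cc-s2-4 gen11, CC4-LEAN §16.10)

noncomputable section

open Complex Filter Set MeasureTheory Topology
open scoped Real

namespace Summit.RiemannHypothesis.RiemannHypothesis.Theorems.SemilocalPolyWitness

open MeasureTheory Set Finset Real
open Literature.NumberTheory.LFunctions
open Summit.RiemannHypothesis.RiemannHypothesis.Theorems.MotivicDoor
open Summit.RiemannHypothesis.RiemannHypothesis.Theorems.MotivicDoor.SemilocalThreshold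
open Summit.RiemannHypothesis.RiemannHypothesis.Theorems.MotivicDoor.SemilocalMarkov
open LQ

set_option maxHeartbeats 0 in
/-- kernel fact: piece `21` of `certSevenKinked1206`. -/
theorem check_SevenKinked1206_piece21 : certSevenKinked1206.checkPiecePW 21 = true := by
  decide +kernel

set_option maxHeartbeats 0 in
/-- kernel fact: piece `22` of `certSevenKinked1206`. -/
theorem check_SevenKinked1206_piece22 : certSevenKinked1206.checkPiecePW 22 = true := by
  decide +kernel

set_option maxHeartbeats 0 in
/-- kernel fact: piece `23` of `certSevenKinked1206`. -/
theorem check_SevenKinked1206_piece23 : certSevenKinked1206.checkPiecePW 23 = true := by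
  decide +kernel

set_option maxHeartbeats 0 in
/-- kernel fact: piece `24` of `certSevenKinked1206`. -/
theorem check_SevenKinked1206_piece24 : certSevenKinked1206.checkPiecePW 24 = true := by
  decide +kernel

set_option maxHeartbeats 0 in
/-- kernel fact: piece `25` of `certSevenKinked1206`. -/
theorem check_SevenKinked1206_piece25 : certSevenKinked1206.checkPiecePW 25 = true := by
  decide +kernel

set_option maxHeartbeats 0 in
/-- kernel fact: piece `26` of `certSevenKinked1206`. -/
theorem check_SevenKinked1206_piece26 : certSevenKinked1206.checkPiecePW 26 = true := by
  decide +kernel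

set_option maxHeartbeats 0 in
/-- kernel fact: piece `27` of `certSevenKinked1206`. -/
theorem check_SevenKinked1206_piece27 : certSevenKinked1206.checkPiecePW 27 = true := by
  decide +kernel

set_option maxHeartbeats 0 in
/-- kernel fact: piece `28` of `certSevenKinked1206`. -/
theorem check_SevenKinked1206_piece28 : certSevenKinked1206.checkPiecePW 28 = true := by
  decide +kernel

set_option maxHeartbeats 0 in
/-- kernel fact: piece `29` of `certSevenKinked1206`. -/
theorem check_SevenKinked1206_piece29 : certSevenKinked1206.checkPiecePW 29 = true := by
  decide +kernel

set_option maxHeartbeats 0 in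
/-- kernel fact: piece `30` of `certSevenKinked1206`. -/
theorem check_SevenKinked1206_piece30 : certSevenKinked1206.checkPiecePW 30 = true := by
  decide +kernel

set_option maxHeartbeats 0 in
/-- kernel fact: piece `31` of `certSevenKinked1206`. -/
theorem check_SevenKinked1206_piece31 : certSevenKinked1206.checkPiecePW 31 = true := by
  decide +kernel

set_option maxHeartbeats 0 in
/-- kernel fact: piece `32` of `certSevenKinked1206`. -/
theorem check_SevenKinked1206_piece32 : certSevenKinked1206.checkPiecePW 32 = true := by
  decide +kernel

set_option maxHeartbeats 0 in
/-- kernel fact: piece `33` of `certSevenKinked1206`. -/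
theorem check_SevenKinked1206_piece33 : certSevenKinked1206.checkPiecePW 33 = true := by
  decide +kernel

set_option maxHeartbeats 0 in
/-- kernel fact: piece `34` of `certSevenKinked1206`. -/
theorem check_SevenKinked1206_piece34 : certSevenKinked1206.checkPiecePW 34 = true := by
  decide +kernel

set_option maxHeartbeats 0 in
/-- kernel fact: piece `35` of `certSevenKinked1206`. -/
theorem check_SevenKinked1206_piece35 : certSevenKinked1206.checkPiecePW 35 = true := by
  decide +kernel

set_option maxHeartbeats 0 in
/-- kernel fact: piece `36` of `certSevenKinked1206`. -/
theorem check_SevenKinked1206_piece36 : certSevenKinked1206.checkPiecePW 36 = true := by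
  decide +kernel

set_option maxHeartbeats 0 in
/-- kernel fact: piece `37` of `certSevenKinked1206`. -/
theorem check_SevenKinked1206_piece37 : certSevenKinked1206.checkPiecePW 37 = true := by
  decide +kernel

set_option maxHeartbeats 0 in
/-- kernel fact: piece `38` of `certSevenKinked1206`. -/
theorem check_SevenKinked1206_piece38 : certSevenKinked1206.checkPiecePW 38 = true := by
  decide +kernel

set_option maxHeartbeats 0 in
/-- kernel fact: piece `39` of `certSevenKinked1206`. -/
theorem check_SevenKinked1206_piece39 : certSevenKinked1206.checkPiecePW 39 = true := by
  decide +kernel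

set_option maxHeartbeats 0 in
/-- kernel fact: piece `40` of `certSevenKinked1206`. -/
theorem check_SevenKinked1206_piece40 : certSevenKinked1206.checkPiecePW 40 = true := by
  decide +kernel

set_option maxHeartbeats 0 in
/-- kernel fact: piece `41` of `certSevenKinked1206`. -/
theorem check_SevenKinked1206_piece41 : certSevenKinked1206.checkPiecePW 41 = true := by
  decide +kernel

set_option maxHeartbeats 0 in
/-- kernel fact: piece `42` of `certSevenKinked1206`. -/
theorem check_SevenKinked1206_piece42 : certSevenKinked1206.checkPiecePW 42 = true := by
  decide +kernel

end Summit.RiemannHypothesis.RiemannHypothesis.Theorems.SemilocalPolyWitness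

end
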